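import Summits.QuantumFields.YangMills.Theorems.UnitScaleTiltProp7BlockPoincareKerTopMean
import Summits.QuantumFields.YangMills.Theorems.UnitScaleTiltProp7NestedMeanTowerClosenessRefMean
import Summits.QuantumFields.YangMills.Theorems.UnitScaleTiltProp7CmapTwSReadSet
import Summits.QuantumFields.YangMills.Theorems.UnitScaleTiltProp7CovariantBlockBumpsProfile
import HarnessLib

/-!
# Route `UnitScaleTilt`, crux K1 «MinimiserStabilityRegPr» (stmt-QuantumFields-19200), EX positivity block, LOD ∕ Combes–Thomas line (★p1 g24 `LOCATE-P349-CT`, ★★OWNER RULINGS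
# №33 ∕ №34) — **PEN (BUMP), FILE 2∕3: THE CORNER-AXIAL DRESSED PARABOLA BUMP AT A T³ MEMBER AND ITS ROWS** — `E_ref c (x) := w̄(x)·C_{y,x}⁻¹ c(y) C_{y,x}`, `y = B^{K−n}(x)`, with
# `w̄ = (ℓ^d∕mass)·Π_ν (x_ν mod ℓ)(ℓ − 1 − x_ν mod ℓ)` (`ℓ = L^{K−n}`, block mass `ℓ^d = (L^d)^{K−n}`) and `C_{y,x} = (axialT U₀♭ corner_y (embIter (K−n) y))⁻¹·axialT U₀♭ corner_y x`
# THE CORNER-AXIAL REFERENCE OF ROW-T (✓`Prop7NestedMeanTowerCloseness*`): (§1) summation rows — a field dominated pointwise ∕ per bond by the coarse data `c(B^k(x))` has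
# `‖toL2S f‖² ≤ 2c₀A²(L^d)^kΣ_y‖c(y)‖²` and `‖D^η_{U₀}(toL2S f)‖² ≤ 2c₀η⁻²B²d(L^d)^kΣ_y‖c(y)‖²`; (§2) the bump's rows — its corner-axial REFERENCE MEAN IS `c` EXACTLY, its block `ℓ¹`-mass
# is `(L^d)^{K−n}‖c(y)‖`, `‖E_ref c(x)‖ ≤ (27∕4)^d‖c(y)‖`, and per fine bond `‖U₀(b)E_ref c(x+e_ν)U₀(b)⋆ − E_ref c(x)‖ ≤ (2(27∕4)^d·6(ℓ−1)ε₀η² + (27∕4)^d·4∕ℓ)·‖c(y)‖` on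
# `PlaqSmall (regThreshold F n K ε₀) U₀`

Cell `ym3-torus` (HUMAN RULING D-0037: YM₃ on T³ is ladder rung R3 — NOT d = 4, NOT infinite volume, NOT a mass gap, NOT Clay).  Width seat `ym3-torus-px10` (gen 9); chair ★p1 g24
2026-08-29T21:49:33Z «px10 g9 ← (BUMP)»; LOCATE `HOME/ym3-torus-px10/g9/LOCATE-BUMP-px10g9.md` (19200 evidence #51).  THEOREMS ONLY (0 `def`, 0 `sorry`); the bump is written OUT
(no definition) exactly as ROW-T writes its references.  `--supports stmt-QuantumFields-19200 --as helper`, count-neutral.  HONEST LABEL (№33 (6)): interpolant ∕ restoration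
LETTERS of the curved γ-row supplier line (LOD localisation), which has ONE [B9] Thm 3.1-class Agmon brick (L3′) inside (Track A road cited); NOTHING of (3.49), Thm 3.3, `h349`,
`hGF`, EX or the crux is proved.  WHY THE SINGLE CORNER-AXIAL FRAME (LOCATE-BUMP (W1)): dressing with the HIERARCHICAL frame of the nested mean's own recursion makes `Q″E = 1` free but
is NOT `H¹`-bounded uniformly in `K − n` (the frame jumps across every sub-level block face); the single frame is smooth by [Balaban1985RegularSpaces] Lemma 1
(✓`norm_axialGauge_bond_sub_one_le_T3`: every in-block link is `6(L^{K−n} − 1)ε₀η²`-close to `1`) and exactness is restored in FILE 3 by a Neumann step over ROW-T.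

THE MATHEMATICS.  (§1) ✓`Prop7NestedMeanPoincare.normSq_toL2S_le_two_mul` ∕ `normSq_toL2_eq` + ✓`DL2_apply` (`(toL2⁻¹D^η toL2S f)(b) = η⁻¹(U₀(b)f(b₊)U₀(b)⋆ − f(b₋))`,
✓`conjR_unitsField_toUField`), Frobenius `≤ 2·`operator² (✓`sum_norm_sq_le_mul_opNorm_sq`), and `Σ_x G(B^k(x)) = (L^d)^k Σ_y G(y)` (✓`card_iterBlock`).  (§2) `C(C⁻¹cC)C⁻¹ = c` (✓`B7Eq125RightInverse.conjR_conjR_inv`)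
summed against `Σ_{B(y)}w̄ = (L^d)^{K−n}`; `‖w̄ C⁻¹cC‖ = w̄‖c‖` (`U1` conjugation, ✓`norm_conjR`, ✓`ref_T3_mem_U1`); `ℓ^d∕mass ≤ (27∕ℓ²)^d` (FILE 1 `mass_ge`) against `Πτ ≤ (ℓ²∕4)^d`;
per bond FILE 1 `profile_bond` ⊕ `norm_transport_dressed_sub_le` with `h = axialT·U₀♭(b)·axialT⁻¹ = gaugeActT (axialT U₀♭ corner) U₀♭ b` (✓`gaugeActT_apply`).

References: T. Bałaban, CMP **99** (1985) 389–434 [Balaban1985BackgroundPropagators] ((3.3) p.391, (3.11) p.392, (3.19) p.393); CMP **98** (1985) 17–51 [Balaban1985Averaging]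
((18)–(20) p.21, (97) p.32); CMP **99** (1985) 75–102 [Balaban1985RegularSpaces] (Lemma 1 (1.25) p.79); CMP **95** (1984) 17–40 [Balaban1984PropagatorsI] ((1.18) p.20);
CMP **102** (1985) 277–309 [Balaban1985Variational] ((2) p.278); CMP **102** (1985) 255–275 [Balaban1985UV3] ((1)–(3) p.256).
-/

set_option autoImplicit false

noncomputable section

open scoped BigOperators Matrix.Norms.L2Operator

namespace Summit.QuantumFields.YangMills.Theorems.Prop7CovariantBlockBumpsRows

open Literature.MathematicalPhysics.QuantumFieldTheory.Balaban1983to89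
open Finset T4Continuum BlockAveraging
open B5Eq118OneStroke (iterBlockOf iterBlock mem_iterBlock val_iterBlockOf card_iterBlock)
open B15DeterminingSets (embIter)
open B7Prop1Explicit (U1 mem_U1 treeWord disp)
open B7Eq78Linearization (conjR conjR_apply conjR_sub conjR_smul)
open B8Ineq132 (norm_conjR norm_conjR_le conjR_conjR)
open B10Eq27TorusAxialLog (holT axialT transl unitsField toUField gaugeActT gaugeActT_apply)
open B7TransferAnalyticMean (meanCLM)
open B11Eq103H1Complex (SiteL2K)
open T3ContinuumYM3Torus
open T3RegularMinimiser (regThreshold regThreshold_pos)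
open T3PrintedRegularMinimiser (RegPr)
open T3SectALandauChart (eta eta_pos bgUnits)
open Summit.QuantumFields.YangMills.Theorems.Prop8Chart (emlIterU)
open Summit.QuantumFields.YangMills.Theorems.Prop7SectET3Transport (periodsT3 bgOfCfg bondEquiv isUnitaryBg_bgOfCfg val_bgOfCfg)
open Summit.QuantumFields.YangMills.Theorems.Prop7SectET3HilbertLetters (W₂ toL2S toL2 DL2 DL2_apply)
open Summit.QuantumFields.YangMills.Theorems.Prop7NestedMeanTowerCloseness (norm_nsTop_sub_refMean_le_of_regPr ref_T3_mem_U1 norm_axialGauge_bond_sub_one_le_T3)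
open Summit.QuantumFields.YangMills.Theorems.Prop7NestedMeanPoincare (normSq_toL2S_eq normSq_toL2_eq normSq_toL2S_le_two_mul conjR_unitsField_toUField)
open Summit.QuantumFields.YangMills.Theorems.Prop7CovariantCoercivity (sum_norm_sq_le_mul_opNorm_sq)
open Summit.QuantumFields.YangMills.Theorems.Prop7CovariantBlockBumpsProfile

variable (F : T3Family) {n K : ℕ}

/-! ## §1 Summation rows: a block-dressed field with pointwise and per-bond bounds by the coarse data has `L²` and `H¹` norms `≲ c₀ℓ³·Σ_y‖c(y)‖²` -/

section Summation

/-- `Σ_x G(B^k(x)) = |B^k|·Σ_y G(y)`: a fine sum of a block-constant function. [cite: Balaban1984PropagatorsI, (1.18) p.20] -/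
theorem sum_site_blockConst {k : ℕ} (hk : k ≤ (F.P K).m + (F.P K).K) (G : Site (F.P K) k → ℝ) :
    ∑ x : Site (F.P K) 0, G (iterBlockOf k x) = (((F.P K).L ^ (F.P K).d) ^ k : ℕ) * ∑ y : Site (F.P K) k, G y := by
  classical
  rw [← sum_fiberwise (s := (univ : Finset (Site (F.P K) 0))) (g := fun x => iterBlockOf k x) (f := fun x => G (iterBlockOf k x)), mul_sum]
  refine sum_congr rfl fun y _ => ?_
  have hfilter : (univ.filter fun x : Site (F.P K) 0 => iterBlockOf k x = y) = iterBlock k y := rfl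
  rw [sum_congr rfl (fun x hx => by rw [(mem_filter.1 hx).2] : ∀ x ∈ univ.filter (fun x : Site (F.P K) 0 => iterBlockOf k x = y), G (iterBlockOf k x) = G y),
    sum_const, hfilter, card_iterBlock k hk, nsmul_eq_mul]

/-- ★ **THE `L²` ROW OF A BLOCK-DOMINATED FIELD**: `‖f(x)‖ ≤ A·‖c(B^k(x))‖` for all `x` ⟹ `‖toL2S f‖² ≤ 2c₀·A²·(L^d)^k·Σ_y‖c(y)‖²`.
[cite: Balaban1985Averaging, (18)–(19) p.21; Balaban1984PropagatorsI, (1.18) p.20] -/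
theorem normSq_toL2S_le_of_blockDominated {k : ℕ} (hk : k ≤ (F.P K).m + (F.P K).K) {c₀ : ℝ} [Fact (0 < c₀)]
    (f : Site (F.P K) 0 → Matrix (Fin 2) (Fin 2) ℂ) (c : Site (F.P K) k → Matrix (Fin 2) (Fin 2) ℂ) {A : ℝ}
    (hf : ∀ x, ‖f x‖ ≤ A * ‖c (iterBlockOf k x)‖) :
    ‖toL2S F K c₀ f‖ ^ 2 ≤ 2 * c₀ * (A ^ 2 * (((F.P K).L ^ (F.P K).d) ^ k : ℕ) * ∑ y : Site (F.P K) k, ‖c y‖ ^ 2) := by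
  have hc : 0 < c₀ := Fact.out
  refine (normSq_toL2S_le_two_mul F f).trans (mul_le_mul_of_nonneg_left ?_ (by positivity))
  calc ∑ x : Site (F.P K) 0, ‖f x‖ ^ 2 ≤ ∑ x : Site (F.P K) 0, A ^ 2 * ‖c (iterBlockOf k x)‖ ^ 2 :=
        sum_le_sum fun x _ => by
          have h := hf x
          have h0 : 0 ≤ ‖f x‖ := norm_nonneg _
          calc ‖f x‖ ^ 2 ≤ (A * ‖c (iterBlockOf k x)‖) ^ 2 := pow_le_pow_left₀ h0 h 2
            _ = A ^ 2 * ‖c (iterBlockOf k x)‖ ^ 2 := by ring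
    _ = A ^ 2 * (((F.P K).L ^ (F.P K).d) ^ k : ℕ) * ∑ y : Site (F.P K) k, ‖c y‖ ^ 2 := by
        rw [← mul_sum, sum_site_blockConst F hk (fun y => ‖c y‖ ^ 2), mul_assoc]

/-- **THE `H¹` NORM IN BOND LETTERS** (an upper bound): `‖D^η_{U₀}(toL2S f)‖² ≤ 2c₀·η⁻²·Σ_b‖U₀(b)f(b₊)U₀(b)⋆ − f(b₋)‖²_op` — ✓`DL2_apply` read through ✓`normSq_toL2_eq`, Frobenius
`≤ 2·`operator². [cite: Balaban1985BackgroundPropagators, (3.3) p.391, (3.11) p.392] -/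
theorem normSq_DL2_le_two_mul_sum {c₀ : ℝ} [Fact (0 < c₀)] (U₀ : GaugeField (F.P K) 0 (Matrix.specialUnitaryGroup (Fin 2) ℂ))
    (f : Site (F.P K) 0 → Matrix (Fin 2) (Fin 2) ℂ) :
    ‖DL2 F n K c₀ U₀ (toL2S F K c₀ f)‖ ^ 2
      ≤ 2 * c₀ * ((eta F n K)⁻¹ ^ 2 * ∑ b : PBond (F.P K) 0, ‖conjR (bgUnits F K U₀ b) (f b.tgt) - f b.src‖ ^ 2) := by
  have hc : 0 < c₀ := Fact.out
  have hη : 0 < eta F n K := eta_pos F n K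
  set G : PBond (F.P K) 0 → Matrix (Fin 2) (Fin 2) ℂ := (toL2 F K c₀).symm (DL2 F n K c₀ U₀ (toL2S F K c₀ f)) with hGdef
  have hG : ∀ b, G b = (((eta F n K : ℝ) : ℂ)⁻¹) • (conjR (bgUnits F K U₀ b) (f b.tgt) - f b.src) := by
    intro b
    have hinv : ((((bgOfCfg F K U₀ (bondEquiv F K b))⁻¹ : (Matrix (Fin 2) (Fin 2) ℂ)ˣ) : Matrix (Fin 2) (Fin 2) ℂ)) =
        star (((U₀ b : Matrix.specialUnitaryGroup (Fin 2) ℂ) : Matrix (Fin 2) (Fin 2) ℂ)) := by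
      rw [isUnitaryBg_bgOfCfg, val_bgOfCfg, Equiv.symm_apply_apply]
    rw [hGdef, DL2_apply, hinv]
    show _ = _ • (conjR (unitsField (toUField U₀) b) (f b.tgt) - f b.src)
    rw [conjR_unitsField_toUField]
  have hback : DL2 F n K c₀ U₀ (toL2S F K c₀ f) = toL2 F K c₀ G := by rw [hGdef, LinearEquiv.apply_symm_apply]
  rw [hback, normSq_toL2_eq]
  have hsum : ∑ b : PBond (F.P K) 0, ∑ j : Fin 2, ∑ k' : Fin 2, ‖G b j k'‖ ^ 2
      ≤ ∑ b : PBond (F.P K) 0, 2 * ((eta F n K)⁻¹ ^ 2 * ‖conjR (bgUnits F K U₀ b) (f b.tgt) - f b.src‖ ^ 2) :=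
    sum_le_sum fun b _ => (sum_norm_sq_le_mul_opNorm_sq (N := 2) (G b)).trans (le_of_eq (by
      rw [hG, norm_smul, mul_pow, norm_inv, Complex.norm_real, Real.norm_of_nonneg hη.le]
      push_cast
      ring))
  calc c₀ * ∑ b : PBond (F.P K) 0, ∑ j : Fin 2, ∑ k' : Fin 2, ‖G b j k'‖ ^ 2
      ≤ c₀ * ∑ b : PBond (F.P K) 0, 2 * ((eta F n K)⁻¹ ^ 2 * ‖conjR (bgUnits F K U₀ b) (f b.tgt) - f b.src‖ ^ 2) :=
        mul_le_mul_of_nonneg_left hsum hc.le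
    _ = 2 * c₀ * ((eta F n K)⁻¹ ^ 2 * ∑ b : PBond (F.P K) 0, ‖conjR (bgUnits F K U₀ b) (f b.tgt) - f b.src‖ ^ 2) := by
        rw [← mul_sum, ← mul_sum]; ring

/-- ★ **THE `H¹` ROW OF A BLOCK-DOMINATED FIELD**: if every bond has `‖U₀(b)f(b₊)U₀(b)⋆ − f(b₋)‖ ≤ B·‖c(B^k(b₋))‖` then
`‖D^η_{U₀}(toL2S f)‖² ≤ 2c₀·η⁻²·B²·d·(L^d)^k·Σ_y‖c(y)‖²`. [cite: Balaban1985BackgroundPropagators, (3.3) p.391, (3.11) p.392; Balaban1984PropagatorsI, (1.18) p.20] -/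
theorem normSq_DL2_le_of_blockDominated {k : ℕ} (hk : k ≤ (F.P K).m + (F.P K).K) {c₀ : ℝ} [Fact (0 < c₀)]
    (U₀ : GaugeField (F.P K) 0 (Matrix.specialUnitaryGroup (Fin 2) ℂ)) (f : Site (F.P K) 0 → Matrix (Fin 2) (Fin 2) ℂ)
    (c : Site (F.P K) k → Matrix (Fin 2) (Fin 2) ℂ) {B : ℝ}
    (hf : ∀ (x : Site (F.P K) 0) (ν : Fin (F.P K).d), ‖conjR (bgUnits F K U₀ ⟨x, ν⟩) (f (x.shift ν)) - f x‖ ≤ B * ‖c (iterBlockOf k x)‖) :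
    ‖DL2 F n K c₀ U₀ (toL2S F K c₀ f)‖ ^ 2
      ≤ 2 * c₀ * ((eta F n K)⁻¹ ^ 2 * (B ^ 2 * (F.P K).d * (((F.P K).L ^ (F.P K).d) ^ k : ℕ) * ∑ y : Site (F.P K) k, ‖c y‖ ^ 2)) := by
  have hc : 0 < c₀ := Fact.out
  refine (normSq_DL2_le_two_mul_sum F U₀ f).trans (mul_le_mul_of_nonneg_left (mul_le_mul_of_nonneg_left ?_ (by positivity)) (by positivity))
  rw [B10StarCount.sum_pbond]
  calc ∑ x : Site (F.P K) 0, ∑ ν : Fin (F.P K).d, ‖conjR (bgUnits F K U₀ ⟨x, ν⟩) (f (PBond.tgt ⟨x, ν⟩)) - f (PBond.src ⟨x, ν⟩)‖ ^ 2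
      ≤ ∑ x : Site (F.P K) 0, ∑ _ν : Fin (F.P K).d, B ^ 2 * ‖c (iterBlockOf k x)‖ ^ 2 :=
        sum_le_sum fun x _ => sum_le_sum fun ν _ => by
          have h := hf x ν
          have h0 : 0 ≤ ‖conjR (bgUnits F K U₀ ⟨x, ν⟩) (f (x.shift ν)) - f x‖ := norm_nonneg _
          calc ‖conjR (bgUnits F K U₀ ⟨x, ν⟩) (f (PBond.tgt ⟨x, ν⟩)) - f (PBond.src ⟨x, ν⟩)‖ ^ 2 ≤ (B * ‖c (iterBlockOf k x)‖) ^ 2 :=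
                pow_le_pow_left₀ h0 h 2
            _ = B ^ 2 * ‖c (iterBlockOf k x)‖ ^ 2 := by ring
    _ = B ^ 2 * (F.P K).d * (((F.P K).L ^ (F.P K).d) ^ k : ℕ) * ∑ y : Site (F.P K) k, ‖c y‖ ^ 2 := by
        have h1 : ∀ x : Site (F.P K) 0, ∑ _ν : Fin (F.P K).d, B ^ 2 * ‖c (iterBlockOf k x)‖ ^ 2 = B ^ 2 * ((F.P K).d * ‖c (iterBlockOf k x)‖ ^ 2) := by
          intro x; rw [sum_const, card_univ, Fintype.card_fin, nsmul_eq_mul]; ring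
        have h2 := sum_site_blockConst F hk (fun y => ‖c y‖ ^ 2)
        simp_rw [h1]
        rw [← mul_sum, ← mul_sum, h2]
        ring

end Summation

/-! ## §2 The corner-axial dressed parabola bump `E_ref c (x) = w̄(x)·C_{y,x}⁻¹ c(y) C_{y,x}` and its rows -/

section Bump

variable {F}

/-- `ℓ = L^{K−n} ≥ 3` at a member with `n < K` (`L ≥ 3` odd). [cite: Balaban1985UV3, (1)-(3) p.256] -/
theorem three_le_blockSide (hnK : n < K) : 3 ≤ (F.P K).L ^ (K - n) := by
  have hL3 : 3 ≤ F.L := by obtain ⟨a, ha⟩ := F.hL.1; have := F.hL.2; omega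
  have h1 : 1 ≤ K - n := by omega
  calc 3 ≤ F.L ^ 1 := by rw [pow_one]; exact hL3
    _ ≤ F.L ^ (K - n) := Nat.pow_le_pow_right (by omega) h1

/-- the normalised profile constant: `ℓ^d ∕ mass ≤ (27∕ℓ²)^d` (`mass ≥ (ℓ³∕27)^d`, ✓`mass_ge`). [folklore] -/
theorem blockSide_pow_div_mass_le {ℓ d : ℕ} (hℓ : 3 ≤ ℓ) :
    ((ℓ : ℝ)) ^ d / (((ℓ : ℝ)) * (((ℓ : ℝ)) - 1) * (((ℓ : ℝ)) - 2) / 6) ^ d ≤ (27 / ((ℓ : ℝ)) ^ 2) ^ d := by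
  have hℓ0 : (0 : ℝ) < ℓ := by exact_mod_cast (show 0 < ℓ by omega)
  have hm : ((ℓ : ℝ)) ^ 3 / 27 ≤ ((ℓ : ℝ)) * (((ℓ : ℝ)) - 1) * (((ℓ : ℝ)) - 2) / 6 := mass_ge hℓ
  have hm0 : 0 < ((ℓ : ℝ)) ^ 3 / 27 := by positivity
  have hmpos : 0 < ((ℓ : ℝ)) * (((ℓ : ℝ)) - 1) * (((ℓ : ℝ)) - 2) / 6 := hm0.trans_le hm
  have hle : ((ℓ : ℝ)) ≤ 27 / ((ℓ : ℝ)) ^ 2 * (((ℓ : ℝ)) * (((ℓ : ℝ)) - 1) * (((ℓ : ℝ)) - 2) / 6) := by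
    rw [div_mul_eq_mul_div, le_div_iff₀ (by positivity)]
    have e : ((ℓ : ℝ)) ^ 3 = ((ℓ : ℝ)) * ((ℓ : ℝ)) ^ 2 := by ring
    nlinarith [hm]
  rw [div_le_iff₀ (pow_pos hmpos d), ← mul_pow]
  exact pow_le_pow_left₀ hℓ0.le hle d

variable (F)

/-- ★ **THE REFERENCE MEAN UNDOES THE DRESSED BUMP EXACTLY**: with the corner-axial references `C_{y,x}` of ROW-T and ANY scalar profile `w̄` normalised to `Σ_{x∈B^k(y)} w̄(x) = (L^d)^k`,
the field `x ↦ w̄(x)·C_{y(x),x}⁻¹ c(y(x)) C_{y(x),x}` has corner-axial reference mean `c(y)` on every block: `(L^d)^{−k}·Σ_{x∈B^k(y)} C_{y,x}(…)C_{y,x}⁻¹ = c(y)`.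
[cite: Balaban1985Averaging, (97) p.32; Balaban1984PropagatorsI, (1.18) p.20] -/
theorem refMean_dressed_eq (U₀ : GaugeField (F.P K) 0 (Matrix.specialUnitaryGroup (Fin 2) ℂ)) (w : Site (F.P K) 0 → ℝ)
    (hwsum : ∀ y : Site (F.P K) (K - n), ∑ x ∈ iterBlock (K - n) y, w x = (((F.P K).L : ℝ) ^ (F.P K).d) ^ (K - n))
    (c : Site (F.P K) (K - n) → Matrix (Fin 2) (Fin 2) ℂ) (y : Site (F.P K) (K - n)) :
    (((((F.P K).L : ℝ) ^ (F.P K).d) ^ (K - n))⁻¹) • ∑ x ∈ iterBlock (K - n) y,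
        conjR ((axialT (bgUnits F K U₀) (Site.fibreSite 0 (K - n) (iterBlockOf (K - n) x) fun _ => (⟨0, pow_pos (F.P K).L_pos (K - n)⟩ : Fin ((F.P K).L ^ (K - n))))
              (embIter (K - n) y))⁻¹ *
          axialT (bgUnits F K U₀) (Site.fibreSite 0 (K - n) (iterBlockOf (K - n) x) fun _ => (⟨0, pow_pos (F.P K).L_pos (K - n)⟩ : Fin ((F.P K).L ^ (K - n)))) x)
          (((w x : ℝ) : ℂ) • conjR ((axialT (bgUnits F K U₀) (Site.fibreSite 0 (K - n) (iterBlockOf (K - n) x) fun _ => (⟨0, pow_pos (F.P K).L_pos (K - n)⟩ : Fin ((F.P K).L ^ (K - n))))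
              (embIter (K - n) (iterBlockOf (K - n) x)))⁻¹ *
            axialT (bgUnits F K U₀) (Site.fibreSite 0 (K - n) (iterBlockOf (K - n) x) fun _ => (⟨0, pow_pos (F.P K).L_pos (K - n)⟩ : Fin ((F.P K).L ^ (K - n)))) x)⁻¹
            (c (iterBlockOf (K - n) x)))
      = c y := by
  have hL0 : (0 : ℝ) < (((F.P K).L : ℝ) ^ (F.P K).d) ^ (K - n) := by have := (F.P K).L_pos; positivity
  have hterm : ∀ x ∈ iterBlock (K - n) y,
      conjR ((axialT (bgUnits F K U₀) (Site.fibreSite 0 (K - n) (iterBlockOf (K - n) x) fun _ => (⟨0, pow_pos (F.P K).L_pos (K - n)⟩ : Fin ((F.P K).L ^ (K - n))))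
              (embIter (K - n) y))⁻¹ *
          axialT (bgUnits F K U₀) (Site.fibreSite 0 (K - n) (iterBlockOf (K - n) x) fun _ => (⟨0, pow_pos (F.P K).L_pos (K - n)⟩ : Fin ((F.P K).L ^ (K - n)))) x)
          (((w x : ℝ) : ℂ) • conjR ((axialT (bgUnits F K U₀) (Site.fibreSite 0 (K - n) (iterBlockOf (K - n) x) fun _ => (⟨0, pow_pos (F.P K).L_pos (K - n)⟩ : Fin ((F.P K).L ^ (K - n))))
              (embIter (K - n) (iterBlockOf (K - n) x)))⁻¹ *
            axialT (bgUnits F K U₀) (Site.fibreSite 0 (K - n) (iterBlockOf (K - n) x) fun _ => (⟨0, pow_pos (F.P K).L_pos (K - n)⟩ : Fin ((F.P K).L ^ (K - n)))) x)⁻¹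
            (c (iterBlockOf (K - n) x)))
        = ((w x : ℝ) : ℂ) • c y := by
    intro x hx
    rw [(mem_iterBlock _ _ _).1 hx, conjR_smul, B7Eq125RightInverse.conjR_conjR_inv]
  rw [← Complex.coe_smul, sum_congr rfl hterm, ← sum_smul, ← Complex.ofReal_sum, hwsum y, smul_smul,
    ← Complex.ofReal_mul, inv_mul_cancel₀ hL0.ne', Complex.ofReal_one, one_smul]

/-- **THE `ℓ¹` MASS OF THE DRESSED BUMP ON A BLOCK**: for a profile `w̄ ≥ 0` with `Σ_{B^k(y)} w̄ = (L^d)^k` and `U1`-dressing, `Σ_{x∈B^k(y)} ‖w̄(x)·C_{y,x}⁻¹c(y)C_{y,x}‖ = (L^d)^k·‖c(y)‖`.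
[cite: Balaban1985Averaging, (19)-(20) p.21; Balaban1984PropagatorsI, (1.18) p.20] -/
theorem sum_norm_dressed_eq (U₀ : GaugeField (F.P K) 0 (Matrix.specialUnitaryGroup (Fin 2) ℂ)) (w : Site (F.P K) 0 → ℝ) (hw0 : ∀ x, 0 ≤ w x)
    (hwsum : ∀ y : Site (F.P K) (K - n), ∑ x ∈ iterBlock (K - n) y, w x = (((F.P K).L : ℝ) ^ (F.P K).d) ^ (K - n))
    (c : Site (F.P K) (K - n) → Matrix (Fin 2) (Fin 2) ℂ) (y : Site (F.P K) (K - n)) :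
    ∑ x ∈ iterBlock (K - n) y,
        ‖((w x : ℝ) : ℂ) • conjR ((axialT (bgUnits F K U₀) (Site.fibreSite 0 (K - n) (iterBlockOf (K - n) x) fun _ => (⟨0, pow_pos (F.P K).L_pos (K - n)⟩ : Fin ((F.P K).L ^ (K - n))))
              (embIter (K - n) (iterBlockOf (K - n) x)))⁻¹ *
            axialT (bgUnits F K U₀) (Site.fibreSite 0 (K - n) (iterBlockOf (K - n) x) fun _ => (⟨0, pow_pos (F.P K).L_pos (K - n)⟩ : Fin ((F.P K).L ^ (K - n)))) x)⁻¹
            (c (iterBlockOf (K - n) x))‖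
      = (((F.P K).L : ℝ) ^ (F.P K).d) ^ (K - n) * ‖c y‖ := by
  have hterm : ∀ x ∈ iterBlock (K - n) y,
      ‖((w x : ℝ) : ℂ) • conjR ((axialT (bgUnits F K U₀) (Site.fibreSite 0 (K - n) (iterBlockOf (K - n) x) fun _ => (⟨0, pow_pos (F.P K).L_pos (K - n)⟩ : Fin ((F.P K).L ^ (K - n))))
              (embIter (K - n) (iterBlockOf (K - n) x)))⁻¹ *
            axialT (bgUnits F K U₀) (Site.fibreSite 0 (K - n) (iterBlockOf (K - n) x) fun _ => (⟨0, pow_pos (F.P K).L_pos (K - n)⟩ : Fin ((F.P K).L ^ (K - n)))) x)⁻¹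
            (c (iterBlockOf (K - n) x))‖ = w x * ‖c y‖ := by
    intro x hx
    rw [norm_smul, Complex.norm_real, Real.norm_of_nonneg (hw0 x), norm_conjR ((U1 _).inv_mem (ref_T3_mem_U1 F U₀ (K - n) _ x)), (mem_iterBlock _ _ _).1 hx]
  rw [sum_congr rfl hterm, ← sum_mul, hwsum y]

/-- ★ **THE POINTWISE ROW OF THE DRESSED PARABOLA BUMP**: with `w̄ = (ℓ^d∕mass)·Π_ν τ(x_ν mod ℓ)` (`ℓ = L^{K−n} ≥ 3`), `‖E_ref c (x)‖ ≤ (27∕4)^d·‖c(B^k(x))‖`.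
[cite: Balaban1985Averaging, (19)-(20) p.21] -/
theorem norm_dressed_le (hnK : n < K) (U₀ : GaugeField (F.P K) 0 (Matrix.specialUnitaryGroup (Fin 2) ℂ))
    (c : Site (F.P K) (K - n) → Matrix (Fin 2) (Fin 2) ℂ) (x : Site (F.P K) 0) :
    ‖((((((F.P K).L ^ (K - n) : ℕ) : ℝ)) ^ (F.P K).d /
          (((((F.P K).L ^ (K - n) : ℕ) : ℝ)) * ((((F.P K).L ^ (K - n) : ℕ) : ℝ) - 1) * ((((F.P K).L ^ (K - n) : ℕ) : ℝ) - 2) / 6) ^ (F.P K).d *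
          ∏ ν : Fin (F.P K).d, (((x ν).val % (F.P K).L ^ (K - n) : ℕ) : ℝ) * ((((F.P K).L ^ (K - n) : ℕ) : ℝ) - 1 - (((x ν).val % (F.P K).L ^ (K - n) : ℕ) : ℝ)) : ℝ) : ℂ) •
        conjR ((axialT (bgUnits F K U₀) (Site.fibreSite 0 (K - n) (iterBlockOf (K - n) x) fun _ => (⟨0, pow_pos (F.P K).L_pos (K - n)⟩ : Fin ((F.P K).L ^ (K - n))))
              (embIter (K - n) (iterBlockOf (K - n) x)))⁻¹ *
            axialT (bgUnits F K U₀) (Site.fibreSite 0 (K - n) (iterBlockOf (K - n) x) fun _ => (⟨0, pow_pos (F.P K).L_pos (K - n)⟩ : Fin ((F.P K).L ^ (K - n)))) x)⁻¹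
            (c (iterBlockOf (K - n) x))‖
      ≤ (27 / 4 : ℝ) ^ (F.P K).d * ‖c (iterBlockOf (K - n) x)‖ := by
  have hℓ3 : 3 ≤ (F.P K).L ^ (K - n) := three_le_blockSide (F := F) hnK
  have hℓ : 0 < (F.P K).L ^ (K - n) := by omega
  have hprof0 := profile_nonneg hℓ x
  have hprof := profile_le hℓ x
  have hA := blockSide_pow_div_mass_le (d := (F.P K).d) hℓ3
  have hA0 : 0 ≤ ((((F.P K).L ^ (K - n) : ℕ) : ℝ)) ^ (F.P K).d /
      (((((F.P K).L ^ (K - n) : ℕ) : ℝ)) * ((((F.P K).L ^ (K - n) : ℕ) : ℝ) - 1) * ((((F.P K).L ^ (K - n) : ℕ) : ℝ) - 2) / 6) ^ (F.P K).d := by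
    have hm : ((((F.P K).L ^ (K - n) : ℕ) : ℝ)) ^ 3 / 27 ≤ _ := mass_ge hℓ3
    have h0 : (0:ℝ) < ((((F.P K).L ^ (K - n) : ℕ) : ℝ)) ^ 3 / 27 := by positivity
    exact div_nonneg (by positivity) (pow_nonneg (h0.le.trans hm) _)
  rw [norm_smul, Complex.norm_real, Real.norm_of_nonneg (mul_nonneg hA0 hprof0), norm_conjR ((U1 _).inv_mem (ref_T3_mem_U1 F U₀ (K - n) _ x))]
  refine mul_le_mul_of_nonneg_right ?_ (norm_nonneg _)
  calc ((((F.P K).L ^ (K - n) : ℕ) : ℝ)) ^ (F.P K).d /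
          (((((F.P K).L ^ (K - n) : ℕ) : ℝ)) * ((((F.P K).L ^ (K - n) : ℕ) : ℝ) - 1) * ((((F.P K).L ^ (K - n) : ℕ) : ℝ) - 2) / 6) ^ (F.P K).d *
          ∏ ν : Fin (F.P K).d, (((x ν).val % (F.P K).L ^ (K - n) : ℕ) : ℝ) * ((((F.P K).L ^ (K - n) : ℕ) : ℝ) - 1 - (((x ν).val % (F.P K).L ^ (K - n) : ℕ) : ℝ))
      ≤ (27 / ((((F.P K).L ^ (K - n) : ℕ) : ℝ)) ^ 2) ^ (F.P K).d * (((((F.P K).L ^ (K - n) : ℕ) : ℝ)) ^ 2 / 4) ^ (F.P K).d :=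
        mul_le_mul hA hprof hprof0 (by positivity)
    _ = (27 / 4 : ℝ) ^ (F.P K).d := by
        rw [← mul_pow]; congr 1; field_simp

/-- ★★ **THE PER-BOND ROW OF THE DRESSED PARABOLA BUMP** (`PlaqSmall (regThreshold F n K ε₀) U₀`, `n < K`): for EVERY fine bond `⟨x, ν⟩`,
`‖U₀(b)·E_ref c(x + e_ν)·U₀(b)⋆ − E_ref c(x)‖ ≤ (2·(27∕4)^d·(6(ℓ − 1)ε₀η²) + (27∕4)^d·(4∕ℓ))·‖c(B^k(x))‖` — inside a block the profile is `ℓ(ℓ²∕4)^{d−1}`-Lipschitz (✓`profile_bond`) and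
the corner-axial link is `6(ℓ−1)ε₀η²`-close to `1` (✓`norm_axialGauge_bond_sub_one_le_T3`, [Balaban1985RegularSpaces] Lemma 1); across a block face both ends vanish.
[cite: Balaban1985RegularSpaces, Lemma 1 (1.25) p.79; Balaban1985BackgroundPropagators, (3.3) p.391; Balaban1985Variational, (2) p.278] -/
theorem norm_transport_dressed_bond_le (hnK : n < K) {ε₀ : ℝ} (hε₀ : 0 < ε₀) (U₀ : GaugeField (F.P K) 0 (Matrix.specialUnitaryGroup (Fin 2) ℂ))
    (hU : PlaqSmall (regThreshold F n K ε₀) U₀) (c : Site (F.P K) (K - n) → Matrix (Fin 2) (Fin 2) ℂ) (x : Site (F.P K) 0) (ν : Fin (F.P K).d) :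
    ‖conjR (bgUnits F K U₀ ⟨x, ν⟩)
        (((((((F.P K).L ^ (K - n) : ℕ) : ℝ)) ^ (F.P K).d /
          (((((F.P K).L ^ (K - n) : ℕ) : ℝ)) * ((((F.P K).L ^ (K - n) : ℕ) : ℝ) - 1) * ((((F.P K).L ^ (K - n) : ℕ) : ℝ) - 2) / 6) ^ (F.P K).d *
          ∏ μ : Fin (F.P K).d, ((((x.shift ν) μ).val % (F.P K).L ^ (K - n) : ℕ) : ℝ) * ((((F.P K).L ^ (K - n) : ℕ) : ℝ) - 1 - ((((x.shift ν) μ).val % (F.P K).L ^ (K - n) : ℕ) : ℝ)) : ℝ) : ℂ) •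
        conjR ((axialT (bgUnits F K U₀) (Site.fibreSite 0 (K - n) (iterBlockOf (K - n) (x.shift ν)) fun _ => (⟨0, pow_pos (F.P K).L_pos (K - n)⟩ : Fin ((F.P K).L ^ (K - n))))
              (embIter (K - n) (iterBlockOf (K - n) (x.shift ν))))⁻¹ *
            axialT (bgUnits F K U₀) (Site.fibreSite 0 (K - n) (iterBlockOf (K - n) (x.shift ν)) fun _ => (⟨0, pow_pos (F.P K).L_pos (K - n)⟩ : Fin ((F.P K).L ^ (K - n)))) (x.shift ν))⁻¹
            (c (iterBlockOf (K - n) (x.shift ν))))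
      - ((((((F.P K).L ^ (K - n) : ℕ) : ℝ)) ^ (F.P K).d /
          (((((F.P K).L ^ (K - n) : ℕ) : ℝ)) * ((((F.P K).L ^ (K - n) : ℕ) : ℝ) - 1) * ((((F.P K).L ^ (K - n) : ℕ) : ℝ) - 2) / 6) ^ (F.P K).d *
          ∏ μ : Fin (F.P K).d, (((x μ).val % (F.P K).L ^ (K - n) : ℕ) : ℝ) * ((((F.P K).L ^ (K - n) : ℕ) : ℝ) - 1 - (((x μ).val % (F.P K).L ^ (K - n) : ℕ) : ℝ)) : ℝ) : ℂ) •
        conjR ((axialT (bgUnits F K U₀) (Site.fibreSite 0 (K - n) (iterBlockOf (K - n) x) fun _ => (⟨0, pow_pos (F.P K).L_pos (K - n)⟩ : Fin ((F.P K).L ^ (K - n))))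
              (embIter (K - n) (iterBlockOf (K - n) x)))⁻¹ *
            axialT (bgUnits F K U₀) (Site.fibreSite 0 (K - n) (iterBlockOf (K - n) x) fun _ => (⟨0, pow_pos (F.P K).L_pos (K - n)⟩ : Fin ((F.P K).L ^ (K - n)))) x)⁻¹
            (c (iterBlockOf (K - n) x))‖
      ≤ (2 * (27 / 4 : ℝ) ^ (F.P K).d * (2 * ((3 : ℝ) * ((F.L : ℝ) ^ (K - n) - 1)) * regThreshold F n K ε₀)
          + (27 / 4 : ℝ) ^ (F.P K).d * (4 / ((((F.P K).L ^ (K - n) : ℕ) : ℝ)))) * ‖c (iterBlockOf (K - n) x)‖ := by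
  have hk : K - n ≤ (F.P K).m + (F.P K).K := Prop7CmapTwSReadSet.height_le F n K
  have hℓ3 : 3 ≤ (F.P K).L ^ (K - n) := three_le_blockSide (F := F) hnK
  have hℓ : 0 < (F.P K).L ^ (K - n) := by omega
  have hd1 : 1 ≤ (F.P K).d := by rw [T3Family.P_d]; norm_num
  -- the profile facts, stated before abbreviating
  have hpb := profile_bond hk x ν
  have hprof' := profile_le hℓ (x.shift ν)
  have hprof0' := profile_nonneg hℓ (x.shift ν)
  have hm := mass_ge hℓ3
  have hA := blockSide_pow_div_mass_le (d := (F.P K).d) hℓ3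
  -- abbreviations
  set ℓr : ℝ := (((F.P K).L ^ (K - n) : ℕ) : ℝ) with hℓrdef
  have hℓr3 : (3 : ℝ) ≤ ℓr := by rw [hℓrdef]; exact_mod_cast hℓ3
  have hℓr0 : 0 < ℓr := by linarith
  set Acoef : ℝ := ℓr ^ (F.P K).d / (ℓr * (ℓr - 1) * (ℓr - 2) / 6) ^ (F.P K).d with hAdef
  have hm0 : (0:ℝ) < ℓr ^ 3 / 27 := by positivity
  have hA0 : 0 ≤ Acoef := div_nonneg (by positivity) (pow_nonneg (hm0.le.trans hm) _)
  have hs0 : 0 ≤ 2 * ((3 : ℝ) * ((F.L : ℝ) ^ (K - n) - 1)) * regThreshold F n K ε₀ := by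
    have h1 : (1 : ℝ) ≤ (F.L : ℝ) ^ (K - n) := one_le_pow₀ (by have := F.hL.2; exact_mod_cast (by omega : 1 ≤ F.L))
    have := (regThreshold_pos F (n := n) (K := K) hε₀).le
    have : (0:ℝ) ≤ (F.L : ℝ) ^ (K - n) - 1 := by linarith
    positivity
  have hc0 : 0 ≤ ‖c (iterBlockOf (K - n) x)‖ := norm_nonneg _
  have h27 : (27 / ℓr ^ 2) ^ (F.P K).d * ((ℓr ^ 2 / 4) ^ (F.P K).d) = (27 / 4 : ℝ) ^ (F.P K).d := by
    rw [← mul_pow]; congr 1; field_simp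
  have h27' : (27 / ℓr ^ 2) ^ (F.P K).d * (ℓr * (ℓr ^ 2 / 4) ^ ((F.P K).d - 1)) = (27 / 4 : ℝ) ^ (F.P K).d * (4 / ℓr) := by
    obtain ⟨e, he⟩ : ∃ e, (F.P K).d = e + 1 := ⟨(F.P K).d - 1, by omega⟩
    rw [he, Nat.add_sub_cancel, pow_succ (27 / ℓr ^ 2) e, pow_succ (27 / 4 : ℝ) e]
    have e1 : (27 / ℓr ^ 2) ^ e * (ℓr ^ 2 / 4) ^ e = (27 / 4 : ℝ) ^ e := by rw [← mul_pow]; congr 1; field_simp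
    calc (27 / ℓr ^ 2) ^ e * (27 / ℓr ^ 2) * (ℓr * (ℓr ^ 2 / 4) ^ e) = ((27 / ℓr ^ 2) ^ e * (ℓr ^ 2 / 4) ^ e) * (27 / ℓr ^ 2 * ℓr) := by ring
      _ = (27 / 4 : ℝ) ^ e * (27 / ℓr ^ 2 * ℓr) := by rw [e1]
      _ = (27 / 4 : ℝ) ^ e * (27 / 4) * (4 / ℓr) := by field_simp
  have hAs : |Acoef * ∏ μ : Fin (F.P K).d, ((((x.shift ν) μ).val % (F.P K).L ^ (K - n) : ℕ) : ℝ) * (ℓr - 1 - ((((x.shift ν) μ).val % (F.P K).L ^ (K - n) : ℕ) : ℝ))|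
      ≤ (27 / 4 : ℝ) ^ (F.P K).d := by
    rw [abs_of_nonneg (mul_nonneg hA0 hprof0'), ← h27]
    exact mul_le_mul hA hprof' hprof0' (by positivity)
  rcases hpb with ⟨hblk, hlip⟩ | ⟨h0', h0⟩
  · -- interior bond: same block, Lipschitz profile, axial link near `1`
    rw [hblk]
    set q := Site.fibreSite 0 (K - n) (iterBlockOf (K - n) x) (fun _ => (⟨0, pow_pos (F.P K).L_pos (K - n)⟩ : Fin ((F.P K).L ^ (K - n)))) with hq
    have hE1 : axialT (bgUnits F K U₀) q (embIter (K - n) (iterBlockOf (K - n) x)) ∈ U1 (Matrix (Fin 2) (Fin 2) ℂ) := by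
      unfold axialT; exact Prop7SymAvgTwSym.holT_mem_U1 (fun b => B11Thm1LevelZero.unitsField_toUField_mem_U1 U₀ b) _ _
    have hAx : axialT (bgUnits F K U₀) q x ∈ U1 (Matrix (Fin 2) (Fin 2) ℂ) := by
      unfold axialT; exact Prop7SymAvgTwSym.holT_mem_U1 (fun b => B11Thm1LevelZero.unitsField_toUField_mem_U1 U₀ b) _ _
    have hAx' : axialT (bgUnits F K U₀) q (x.shift ν) ∈ U1 (Matrix (Fin 2) (Fin 2) ℂ) := by
      unfold axialT; exact Prop7SymAvgTwSym.holT_mem_U1 (fun b => B11Thm1LevelZero.unitsField_toUField_mem_U1 U₀ b) _ _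
    have hW : bgUnits F K U₀ ⟨x, ν⟩ ∈ U1 (Matrix (Fin 2) (Fin 2) ℂ) := B11Thm1LevelZero.unitsField_toUField_mem_U1 U₀ _
    have hlink : ‖((axialT (bgUnits F K U₀) q x * bgUnits F K U₀ ⟨x, ν⟩ * (axialT (bgUnits F K U₀) q (x.shift ν))⁻¹ : (Matrix (Fin 2) (Fin 2) ℂ)ˣ) : Matrix (Fin 2) (Fin 2) ℂ) - 1‖
        ≤ 2 * ((3 : ℝ) * ((F.L : ℝ) ^ (K - n) - 1)) * regThreshold F n K ε₀ := by
      have h := norm_axialGauge_bond_sub_one_le_T3 F hε₀ U₀ hU (iterBlockOf (K - n) x) ⟨x, ν⟩ rfl hblk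
      rwa [gaugeActT_apply] at h
    have hmain := norm_transport_dressed_sub_le hE1 hAx hAx' hW hlink
      (Acoef * ∏ μ : Fin (F.P K).d, (((x μ).val % (F.P K).L ^ (K - n) : ℕ) : ℝ) * (ℓr - 1 - (((x μ).val % (F.P K).L ^ (K - n) : ℕ) : ℝ)))
      (Acoef * ∏ μ : Fin (F.P K).d, ((((x.shift ν) μ).val % (F.P K).L ^ (K - n) : ℕ) : ℝ) * (ℓr - 1 - ((((x.shift ν) μ).val % (F.P K).L ^ (K - n) : ℕ) : ℝ)))
      (c (iterBlockOf (K - n) x))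
    refine hmain.trans (mul_le_mul_of_nonneg_right ?_ hc0)
    have hdiff : |Acoef * ∏ μ : Fin (F.P K).d, ((((x.shift ν) μ).val % (F.P K).L ^ (K - n) : ℕ) : ℝ) * (ℓr - 1 - ((((x.shift ν) μ).val % (F.P K).L ^ (K - n) : ℕ) : ℝ))
          - Acoef * ∏ μ : Fin (F.P K).d, (((x μ).val % (F.P K).L ^ (K - n) : ℕ) : ℝ) * (ℓr - 1 - (((x μ).val % (F.P K).L ^ (K - n) : ℕ) : ℝ))|
        ≤ (27 / 4 : ℝ) ^ (F.P K).d * (4 / ℓr) := by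
      rw [← mul_sub, abs_mul, abs_of_nonneg hA0, ← h27']
      exact mul_le_mul hA hlip (abs_nonneg _) (by positivity)
    exact add_le_add (mul_le_mul_of_nonneg_right (mul_le_mul_of_nonneg_left hAs (by norm_num)) hs0) hdiff
  · -- a bond across a block face: both profile values vanish
    rw [h0', h0]
    simp only [mul_zero, Complex.ofReal_zero, zero_smul, conjR_apply, zero_mul, sub_zero, norm_zero]
    have h4 : (0:ℝ) ≤ (27 / 4 : ℝ) ^ (F.P K).d * (4 / ℓr) := by positivity
    have h5 : (0:ℝ) ≤ 2 * (27 / 4 : ℝ) ^ (F.P K).d * (2 * ((3 : ℝ) * ((F.L : ℝ) ^ (K - n) - 1)) * regThreshold F n K ε₀) := by positivity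
    exact mul_nonneg (add_nonneg h5 h4) hc0

end Bump

end Summit.QuantumFields.YangMills.Theorems.Prop7CovariantBlockBumpsRows

end
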